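import Summits.RiemannHypothesis.RiemannHypothesis.Theorems.OddSectorOddBartaFloorDefs
import Literature.NumberTheory.LFunctions.DeBruijnPhiSecondDeriv
import Literature.NumberTheory.LFunctions.DeBruijnPhiDecreasing
import Mathlib.NumberTheory.ZetaValues
import Mathlib.Analysis.Calculus.MeanValue
import Mathlib.Analysis.Convex.SpecificFunctions.Basic
import HarnessLib

/-!
# Crux `OddSector.OddBartaFloor`, line `Sketch`: the tooth sum and elementary kernel facts

Helper file of the lead's stub `stub_primeLayerFloor` (crux item stmt-RiemannHypothesis-17779, route
`RiemannHypothesis/OddSector`), landing the registered helper stub `stub_toothSum`: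
for `K ≥ 2`, `K ≥ 5e^L`, `L ≥ 0`, `Σ_{n > e^L} e^{−K(log n − L)} ≤ 3` — the sum over the "teeth"
(integers just above `e^{a+t}`) that controls the wrong-sign prime layer at the window edge. Proof by
Bernoulli's inequality (`(1+x)^{K/2} ≥ 1 + Kx/2`), no prime number theory. Also: the bounds
`Λ(n)n^{-1/2} ≤ 2`, `≤ 4/n^{1/4}`, the tail `τ(N) = Σ_k (k+N)^{-2} → 0`, the pointwise form of the
odd tail `R_a`, and `Φ″ = Φ_RT″(·/2)/2`.
-/

set_option linter.dupNamespace false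

noncomputable section

open Set MeasureTheory Filter
open scoped Real Topology ArithmeticFunction.vonMangoldt

namespace Summit.RiemannHypothesis.RiemannHypothesis.Theorems.OddBartaFloor

open Literature.NumberTheory.LFunctions

/-! ## Elementary inequalities -/

/-- Bernoulli squared: `e^{−K log(1+x)}·(Kx)² ≤ 4` for `x > 0`, `K ≥ 2`
(`(1+x)^{K/2} ≥ 1 + (K/2)x ≥ Kx/2`). -/
theorem exp_neg_mul_log_one_add_le {x K : ℝ} (hx : 0 < x) (hK : 2 ≤ K) :
    rexp (-K * Real.log (1 + x)) ≤ 4 / (K * x) ^ 2 := by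
  have h1x : 0 < 1 + x := by linarith
  have hB : 1 + K / 2 * x ≤ (1 + x) ^ (K / 2) :=
    one_add_mul_self_le_rpow_one_add (by linarith) (by linarith)
  have hKx : 0 < K * x := by nlinarith
  have h2 : K * x / 2 ≤ (1 + x) ^ (K / 2) := by linarith
  have h3 : (K * x / 2) ^ 2 ≤ ((1 + x) ^ (K / 2)) ^ 2 := pow_le_pow_left₀ (by positivity) h2 2
  have h4 : ((1 + x) ^ (K / 2)) ^ 2 = rexp (K * Real.log (1 + x)) := by
    rw [← Real.rpow_natCast, ← Real.rpow_mul h1x.le, Real.rpow_def_of_pos h1x]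
    congr 1; push_cast; ring
  rw [show -K * Real.log (1 + x) = -(K * Real.log (1 + x)) by ring, Real.exp_neg, inv_eq_one_div,
    div_le_div_iff₀ (Real.exp_pos _) (by positivity), one_mul]
  rw [h4] at h3
  nlinarith

/-- `log n ≤ 2√n` (from `log y ≤ y − 1` at `y = √n`). -/
theorem log_le_two_mul_sqrt (n : ℕ) : Real.log n ≤ 2 * Real.sqrt n := by
  rcases Nat.eq_zero_or_pos n with rfl | hn
  · simp
  · have hpos : (0 : ℝ) < n := by exact_mod_cast hn
    have h1 : Real.log (Real.sqrt n) ≤ Real.sqrt n - 1 := Real.log_le_sub_one_of_pos (Real.sqrt_pos.2 hpos)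
    rw [Real.log_sqrt hpos.le] at h1
    linarith

/-- `log n ≤ 4 √(√n)` (from `log y ≤ y − 1` at `y = n^{1/4}`). -/
theorem log_le_four_mul_sqrt_sqrt (n : ℕ) : Real.log n ≤ 4 * Real.sqrt (Real.sqrt n) := by
  rcases Nat.eq_zero_or_pos n with rfl | hn
  · simp
  · have hpos : (0 : ℝ) < n := by exact_mod_cast hn
    have hs : 0 < Real.sqrt n := Real.sqrt_pos.2 hpos
    have h1 : Real.log (Real.sqrt (Real.sqrt n)) ≤ Real.sqrt (Real.sqrt n) - 1 :=
      Real.log_le_sub_one_of_pos (Real.sqrt_pos.2 hs)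
    rw [Real.log_sqrt hs.le, Real.log_sqrt hpos.le] at h1
    linarith

/-- The prime weights are bounded: `Λ(n) n^{-1/2} ≤ 2`. -/
theorem vonMangoldt_div_sqrt_le_two (n : ℕ) : (Λ n : ℝ) / Real.sqrt n ≤ 2 := by
  rcases Nat.eq_zero_or_pos n with rfl | hn
  · simp
  · have hpos : (0 : ℝ) < n := by exact_mod_cast hn
    rw [div_le_iff₀ (Real.sqrt_pos.2 hpos)]
    exact ArithmeticFunction.vonMangoldt_le_log.trans (log_le_two_mul_sqrt n)

/-- The prime weights decay: `Λ(n) n^{-1/2} ≤ 4/√(√n)`. -/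
theorem vonMangoldt_div_sqrt_le (n : ℕ) (hn : 0 < n) :
    (Λ n : ℝ) / Real.sqrt n ≤ 4 / Real.sqrt (Real.sqrt n) := by
  have hpos : (0 : ℝ) < n := by exact_mod_cast hn
  have hs : 0 < Real.sqrt n := Real.sqrt_pos.2 hpos
  have hss : 0 < Real.sqrt (Real.sqrt n) := Real.sqrt_pos.2 hs
  rw [div_le_div_iff₀ hs hss]
  have h1 := log_le_four_mul_sqrt_sqrt n
  have h2 : Real.sqrt n = Real.sqrt (Real.sqrt n) * Real.sqrt (Real.sqrt n) := (Real.mul_self_sqrt hs.le).symm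
  calc (Λ n : ℝ) * Real.sqrt (Real.sqrt n) ≤ Real.log n * Real.sqrt (Real.sqrt n) :=
        mul_le_mul_of_nonneg_right ArithmeticFunction.vonMangoldt_le_log hss.le
    _ ≤ 4 * Real.sqrt (Real.sqrt n) * Real.sqrt (Real.sqrt n) := mul_le_mul_of_nonneg_right h1 hss.le
    _ = 4 * Real.sqrt n := by rw [mul_assoc, ← h2]

/-- The prime weights are non-negative. -/
theorem vonMangoldt_div_sqrt_nonneg (n : ℕ) : 0 ≤ (Λ n : ℝ) / Real.sqrt n :=
  div_nonneg ArithmeticFunction.vonMangoldt_nonneg (Real.sqrt_nonneg _)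

/-! ## The sum over the teeth -/

/-- **The tooth sum.** For `K ≥ 2` with `K ≥ 5e^L`, `L ≥ 0`:
`Σ_{n > e^L} e^{−K(log n − L)} ≤ 3` (and the series converges): the first integer above `e^L`
contributes at most `1`, and the `j`-th one after it at most `4n₁²/(K²j²)` by Bernoulli's
inequality, `n₁ ≤ 2e^L ≤ 2K/5`, `Σ 1/j² = π²/6`. -/
theorem tooth_sum_le {L K : ℝ} (hL : 0 ≤ L) (hK : 2 ≤ K) (hKL : 5 * rexp L ≤ K) :
    Summable (fun n : ℕ => if rexp L < (n : ℝ) then rexp (-K * (Real.log n - L)) else 0) ∧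
      ∑' n : ℕ, (if rexp L < (n : ℝ) then rexp (-K * (Real.log n - L)) else 0) ≤ 3 := by
  set N₀ : ℝ := rexp L with hN₀
  have hN₀1 : 1 ≤ N₀ := Real.one_le_exp hL
  set n₁ : ℕ := ⌊N₀⌋₊ + 1 with hn₁
  have hn₁N : N₀ < n₁ := by rw [hn₁]; push_cast; exact Nat.lt_floor_add_one N₀
  have hn₁le : (n₁ : ℝ) ≤ N₀ + 1 := by
    rw [hn₁]; push_cast; linarith [Nat.floor_le (by linarith : 0 ≤ N₀)]
  have hn₁pos : (0 : ℝ) < n₁ := by linarith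
  have hlogn₁ : L ≤ Real.log n₁ := by
    rw [← Real.log_exp L]; exact Real.log_le_log (Real.exp_pos _) hn₁N.le
  set f : ℕ → ℝ := fun n => if rexp L < (n : ℝ) then rexp (-K * (Real.log n - L)) else 0 with hf
  have hf0 : ∀ n, 0 ≤ f n := fun n => by
    simp only [hf]; split_ifs <;> positivity
  have hmem : ∀ n : ℕ, rexp L < (n : ℝ) ↔ n₁ ≤ n := fun n => by
    rw [hn₁, Nat.succ_le_iff, Nat.floor_lt (by linarith)]
  -- the shifted sequence and its majorant
  set g : ℕ → ℝ := fun j => f (j + n₁) with hg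
  set m : ℕ → ℝ := fun j => 4 * (n₁ : ℝ) ^ 2 / K ^ 2 * (1 / (j : ℝ) ^ 2) + if j = 0 then 1 else 0 with hm
  have hgm : ∀ j, g j ≤ m j := fun j => by
    have hcond : rexp L < ((j + n₁ : ℕ) : ℝ) := (hmem _).2 (Nat.le_add_left _ _)
    simp only [hg, hf, if_pos hcond, hm]
    rcases Nat.eq_zero_or_pos j with rfl | hj
    · simp only [zero_add, Nat.cast_zero, ne_eq, OfNat.ofNat_ne_zero, not_false_eq_true, zero_pow,
        div_zero, mul_zero, if_true, zero_add]
      apply Real.exp_le_one_iff.2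
      have : 0 ≤ Real.log n₁ - L := by linarith
      nlinarith
    · rw [if_neg hj.ne', add_zero]
      have hjpos : (0 : ℝ) < j := by exact_mod_cast hj
      set x : ℝ := (j : ℝ) / n₁ with hx
      have hxpos : 0 < x := by positivity
      have hlog : Real.log ((j + n₁ : ℕ) : ℝ) - L ≥ Real.log (1 + x) := by
        have e1 : (1 + x) = ((j + n₁ : ℕ) : ℝ) / n₁ := by
          rw [hx]; push_cast; field_simp; ring
        rw [e1, Real.log_div (by positivity) hn₁pos.ne']
        linarith
      calc rexp (-K * (Real.log ((j + n₁ : ℕ) : ℝ) - L)) ≤ rexp (-K * Real.log (1 + x)) := by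
            apply Real.exp_le_exp.2; nlinarith
        _ ≤ 4 / (K * x) ^ 2 := exp_neg_mul_log_one_add_le hxpos hK
        _ = 4 * (n₁ : ℝ) ^ 2 / K ^ 2 * (1 / (j : ℝ) ^ 2) := by
            rw [hx]; field_simp
  have hmsum : HasSum m (4 * (n₁ : ℝ) ^ 2 / K ^ 2 * (π ^ 2 / 6) + 1) := by
    have h1 := hasSum_zeta_two.mul_left (4 * (n₁ : ℝ) ^ 2 / K ^ 2)
    have h2 : HasSum (fun j : ℕ => if j = 0 then (1 : ℝ) else 0) 1 := hasSum_ite_eq 0 1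
    exact h1.add h2
  have hg0 : ∀ j, 0 ≤ g j := fun j => hf0 _
  have hgsum : Summable g := Summable.of_nonneg_of_le hg0 hgm hmsum.summable
  have hfsum : Summable f := (summable_nat_add_iff n₁).1 hgsum
  refine ⟨hfsum, ?_⟩
  have hsplit := hfsum.sum_add_tsum_nat_add n₁
  have hzero : ∑ i ∈ Finset.range n₁, f i = 0 := Finset.sum_eq_zero fun i hi => by
    have hi' : ¬ rexp L < (i : ℝ) := fun h => by
      have := (hmem i).1 h
      exact absurd (Finset.mem_range.1 hi) (not_lt.2 this)
    simp only [hf, if_neg hi']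
  rw [← hsplit, hzero, zero_add]
  have hle : ∑' j, g j ≤ ∑' j, m j := hgsum.tsum_le_tsum hgm hmsum.summable
  rw [hmsum.tsum_eq] at hle
  refine hle.trans ?_
  -- numerics: `4 n₁² / K² · π²/6 + 1 ≤ 3`
  have hK0 : 0 < K := by linarith
  have hratio : (n₁ : ℝ) / K ≤ 2 / 5 := by
    rw [div_le_div_iff₀ hK0 (by norm_num)]
    nlinarith
  have hsq : (n₁ : ℝ) ^ 2 / K ^ 2 ≤ 4 / 25 := by
    rw [← div_pow]
    have h0 : 0 ≤ (n₁ : ℝ) / K := by positivity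
    nlinarith
  have hpi : π ^ 2 / 6 ≤ 10 / 6 := by
    have := Real.pi_lt_d2
    nlinarith [Real.pi_pos]
  have h1 : 4 * (n₁ : ℝ) ^ 2 / K ^ 2 ≤ 16 / 25 := by
    have : 4 * (n₁ : ℝ) ^ 2 / K ^ 2 = 4 * ((n₁ : ℝ) ^ 2 / K ^ 2) := by ring
    rw [this]; linarith
  have h2 : 4 * (n₁ : ℝ) ^ 2 / K ^ 2 * (π ^ 2 / 6) ≤ 16 / 25 * (10 / 6) :=
    mul_le_mul h1 hpi (by positivity) (by norm_num)
  linarith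

/-- **The tail of `Σ 1/n²`**: `τ(N) = Σ_k 1/(k+N)²`, and `Σ_{n ≥ N} w/n² = w·τ(N)`. -/
theorem tsum_ite_le_eq_tail (N : ℕ) (w : ℝ) :
    ∑' n : ℕ, (if N ≤ n then w / (n : ℝ) ^ 2 else 0) = w * ∑' k : ℕ, 1 / ((k + N : ℕ) : ℝ) ^ 2 := by
  set F : ℕ → ℝ := fun n => if N ≤ n then w / (n : ℝ) ^ 2 else 0 with hF
  have hsum : Summable F := by
    refine Summable.of_norm_bounded ((hasSum_zeta_two.summable).mul_left |w|) fun n => ?_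
    simp only [hF]
    split_ifs
    · rw [Real.norm_eq_abs, abs_div, abs_of_nonneg (by positivity : (0 : ℝ) ≤ (n : ℝ) ^ 2)]
      exact le_of_eq (by ring)
    · simp only [norm_zero]; positivity
  have hsplit := hsum.sum_add_tsum_nat_add N
  have hzero : ∑ i ∈ Finset.range N, F i = 0 := Finset.sum_eq_zero fun i hi => by
    simp only [hF, if_neg (not_le.2 (Finset.mem_range.1 hi))]
  rw [← hsplit, hzero, zero_add, ← tsum_mul_left]
  refine tsum_congr fun k => ?_
  simp only [hF, if_pos (Nat.le_add_left N k)]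
  ring

/-- The tail `τ(N) → 0`. -/
theorem tendsto_tail_zeta_two :
    Tendsto (fun N : ℕ => ∑' k : ℕ, 1 / ((k + N : ℕ) : ℝ) ^ 2) atTop (𝓝 0) :=
  tendsto_sum_nat_add fun n : ℕ => 1 / (n : ℝ) ^ 2

/-- The tail is non-negative. -/
theorem tail_zeta_two_nonneg (N : ℕ) : 0 ≤ ∑' k : ℕ, 1 / ((k + N : ℕ) : ℝ) ^ 2 :=
  tsum_nonneg fun _ => by positivity

/-! ## The odd tail pointwise -/

/-- On the closed window the odd tail vanishes. -/
theorem oddThetaTail_of_mem {a x : ℝ} (hx : x ∈ Icc (-a) a) : oddThetaTail a x = 0 := by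
  rw [oddThetaTail_def, weilOddThetaVector_of_mem hx]; ring

/-- Off the window the odd tail is `−Φ′`. -/
theorem oddThetaTail_of_not_mem {a x : ℝ} (hx : x ∉ Icc (-a) a) : oddThetaTail a x = -weilThetaPhiDeriv x := by
  rw [oddThetaTail_def, weilOddThetaVector_of_not_mem hx]; ring

/-- `Φ′` is differentiable with `Φ″(ξ) = Φ_RT″(ξ/2)/2`. -/
theorem hasDerivAt_weilThetaPhiDeriv (ξ : ℝ) :
    HasDerivAt weilThetaPhiDeriv (deBruijnPhiDeriv₂ (ξ / 2) * (1 / 2)) ξ := by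
  have h2 : HasDerivAt (fun x : ℝ => x / 2) (1 / 2) ξ := by simpa using (hasDerivAt_id ξ).div_const 2
  have h := (hasDerivAt_deBruijnPhiDeriv (ξ / 2)).comp ξ h2
  exact h

/-- **The tooth sum** (registered helper stub `stub_toothSum`; see `tooth_sum_le`). -/
theorem stub_toothSum :
    ∀ (L K : ℝ), 0 ≤ L → 2 ≤ K → 5 * rexp L ≤ K →
      Summable (fun n : ℕ => if rexp L < (n : ℝ) then rexp (-K * (Real.log n - L)) else 0) ∧
        ∑' n : ℕ, (if rexp L < (n : ℝ) then rexp (-K * (Real.log n - L)) else 0) ≤ 3 :=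
  fun _ _ hL hK hKL => tooth_sum_le hL hK hKL

end Summit.RiemannHypothesis.RiemannHypothesis.Theorems.OddBartaFloor

end
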